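import Summits.NavierStokesRegularity.NavierStokesRegularity.Theorems.ExtremiserTransienceNearExtremalTransienceExtremiserLiouvilleConstantSpeedTailLaw
import Summits.NavierStokesRegularity.NavierStokesRegularity.Theorems.ExtremiserTransienceNearExtremalTransienceExtremiserLiouvilleConstantSpeedAxialDossierV3
import HarnessLib

/-!
# Crux `ExtremiserTransience.NearExtremalTransience` (stmt-NavierStokesRegularity-21883), line `extremiser_liouville`,
# stub K1b — AXIAL DOSSIER v4: the residue object obeys the quantitative SLAB and TAIL laws

`--supports stmt-NavierStokesRegularity-21883` (helper).  Author: prover seat `ns-el-k1b` (g7).  Two things: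

* `tailDirichlet_jet`, `tailDirichlet_jet_exterior` — the DIRICHLET-ENERGY TAIL of a residue jet,
  `∫_{S ⊆ {2R ≤ ‖x‖}} |Dv|²_F ≤ C/√R`: local gradient energy is local enstrophy plus a weighted excess energy
  (`…ConstantSpeedSlabTools.integral_mul_frobeniusNormSq_fderiv_le`: `∫θ|Dv|²_F ≤ ∫θ‖ω‖² + ∫‖D∇θ‖‖v − c‖²`), fed with the
  radial tail law (`…ConstantSpeedTailLaw.tailLaw_jet_cutoff`) and the weighted energy of the annular cut-off
  (`…ConstantSpeedTailTools.radialCutoff_weighted_energies`, `≤ 19KE₀/R`);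
* `stub_noAnalyticExtremal_of_noAxialResidueObject₄` — the dossier v3 (`…AxialDossierV3`, p707426) with two more recorded
  properties of the residue object in the jet case: (SL) the slab law `W∫_S‖ω‖² + Z∫_S|Dω|²_F ≤ C/R`, `∫_S|Dw|²_F ≤ C/R` for
  bounded measurable `S ⊆ {R/2 ≤ x₂ ≤ 6R}` (`…SlabRateJet.jet_slabRate`, p707536) and (TL) the radial tail laws
  `W∫‖ω‖² + Z∫|Dω|²_F ≤ C/√R`, `∫|Dw|²_F ≤ C/√R` over `{2R ≤ ‖x‖}` (`…TailLaw`, p711082, and this file).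
What is left for K1b is unchanged (pancake jets / flat slab: horizontal escape at fixed height), but the next seat now has the
residue's quantitative decay at both the axial and the radial scale on record.  K1b is NOT proved; nothing here proves NS
regularity. [folklore]
-/

noncomputable section

open Set Filter Topology MeasureTheory Metric Function Real Bornology
open scoped ENNReal NNReal Topology InnerProductSpace RealInnerProductSpace ContDiff Laplacian

namespace Summit.NavierStokesRegularity.NavierStokesRegularity.Theorems

-- the problem directory repeats the summit name (`NavierStokesRegularity/NavierStokesRegularity`)
set_option linter.dupNamespace false

namespace ExtremiserLiouville

open Literature.Analysis.FluidPDE Literature.Analysis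
open DepletionLadder.KStar DepletionLadder.KStar.HalfSpace

variable {v : E3 → E3} {c : E3}

/-- **THE DIRICHLET-ENERGY TAIL OF THE RESIDUE JET.**  See the module docstring. [folklore] -/
theorem tailDirichlet_jet
    (hv : ContDiff ℝ ∞ v) (hdiv : VectorCalculus.IsDivFree v) {M B : ℝ} (hMpos : 0 < M)
    (hM : ∀ x, ‖v x‖ = M) (hcM : ‖c‖ = M) (hB : ∀ x, ‖fderiv ℝ v x‖ ≤ B)
    (h1 : ∫⁻ x, ‖iteratedFDeriv ℝ 1 v x‖ₑ ^ 2 < ⊤) (h2 : ∫⁻ x, ‖iteratedFDeriv ℝ 2 v x‖ₑ ^ 2 < ⊤)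
    (hpos : 0 < M * Real.sqrt (Zen v) * Real.sqrt (Wpa v))
    (hatt : |Jst v| = kStar * M * Real.sqrt (Zen v) * Real.sqrt (Wpa v))
    (hc0 : c 0 = 0) (hc1 : c 1 = 0) (hc2 : c 2 ≠ 0)
    (hfar : Tendsto (fun x => v x - c) (cocompact E3) (𝓝 0))
    (hslab : ∀ T : ℝ, 0 < T → Integrable (fun x => {x : E3 | |x 2| ≤ T}.indicator (fun x => ‖v x - c‖ ^ 2) x) volume)
    {E₀ : ℝ} (hE0 : 0 ≤ E₀) (hE : ∀ s : ℝ, (∫ x, deriv Real.smoothTransition (x 2 - s) * ‖v x - c‖ ^ 2) = E₀) :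
    ∃ C : ℝ, 0 ≤ C ∧ ∃ R₀ : ℝ, 1 ≤ R₀ ∧ ∀ R : ℝ, R₀ ≤ R → ∀ S : Set E3, MeasurableSet S → IsBounded S →
      S ⊆ {x : E3 | 2 * R ≤ ‖x‖} → (∫ x in S, frobeniusNormSq (fderiv ℝ v x)) ≤ C / Real.sqrt R := by
  have hKst : 0 < kStar := kStar_pos
  have hZ0 : 0 ≤ Zen v := integral_nonneg fun x => sq_nonneg _
  have hWpos : 0 < Wpa v := by
    have h : 0 < Real.sqrt (Wpa v) := pos_of_mul_pos_right hpos (by positivity)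
    exact Real.sqrt_pos.1 h
  -- far field
  obtain ⟨r₀, hr₀⟩ : ∃ r₀ : ℝ, ∀ x : E3, r₀ ≤ ‖x‖ → ‖v x - c‖ ≤ kStar * M / 3 := by
    have hδ : 0 < kStar * M / 3 := by positivity
    have h : (fun x => v x - c) ⁻¹' Metric.ball (0 : E3) (kStar * M / 3) ∈ cocompact E3 :=
      hfar (Metric.ball_mem_nhds (0 : E3) hδ)
    rw [mem_cocompact] at h
    obtain ⟨Kc, hKc, hKsub⟩ := h
    obtain ⟨ρ, hρ⟩ := (Metric.isBounded_iff_subset_closedBall (0 : E3)).1 hKc.isBounded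
    refine ⟨ρ + 1, fun x hx => ?_⟩
    have hxK : x ∉ Kc := fun hmem => by
      have := hρ hmem; rw [mem_closedBall, dist_zero_right] at this; linarith
    have := hKsub hxK
    rw [mem_preimage, Metric.mem_ball, dist_zero_right] at this
    exact this.le
  obtain ⟨C, hC0, hC⟩ := tailLaw_jet_cutoff hv hdiv hMpos hM hcM hB h1 h2 hpos hatt hc0 hc1 hc2 hslab hE0 hE hr₀
  obtain ⟨K, hK0, hK⟩ := exists_radialCutoff_weights
  refine ⟨C / Wpa v + 19 * K * E₀, by positivity, max 1 r₀, le_max_left _ _, fun R hR S hS hSb hSsub => ?_⟩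
  have hR1 : 1 ≤ R := (le_max_left _ _).trans hR
  have hR0 : 0 < R := one_pos.trans_le hR1
  obtain ⟨ρ₁, hρ₁⟩ := (Metric.isBounded_iff_subset_closedBall (0 : E3)).1 hSb
  set R' : ℝ := max (4 * R) ρ₁ with hR'def
  have hRR' : 4 * R ≤ R' := le_max_left _ _
  have hR'0 : 0 < R' := by positivity
  set θ : E3 → ℝ := fun x : E3 => (1 - cutoff R x) * cutoff R' x with hθdef
  have hθ : ContDiff ℝ ∞ θ := contDiff_radialCutoff R R'
  have hθc : HasCompactSupport θ := hasCompactSupport_radialCutoff R hR'0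
  have hθ0 : ∀ x, 0 ≤ θ x := fun x => (radialCutoff_nonneg_le_one R R' x).1
  -- the three inputs
  have hkey : Wpa v * (∫ x, θ x * ‖curl v x‖ ^ 2) + Zen v * (∫ x, θ x * frobeniusNormSq (fderiv ℝ (curl v) x)) ≤
      C / Real.sqrt R := hC R R' hR hRR'
  obtain ⟨hT3', -⟩ := radialCutoff_weighted_energies hv hdiv hM hcM hc0 hc1 hc2 hslab hE0 hE hK0 hR1 hRR' (hK R R' hR1 hRR')
  have hT3 : (∫ x, ‖fderiv ℝ (gradient θ) x‖ * ‖v x - c‖ ^ 2) ≤ 19 * K * E₀ / R := hT3'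
  have hloc := integral_mul_frobeniusNormSq_fderiv_le (c := c) hv hdiv hθ hθc
  -- local enstrophy from the tail law
  have hF0 : 0 ≤ ∫ x, θ x * frobeniusNormSq (fderiv ℝ (curl v) x) :=
    integral_nonneg fun x => mul_nonneg (hθ0 x) (frobeniusNormSq_nonneg _)
  have hZθ : (∫ x, θ x * ‖curl v x‖ ^ 2) ≤ C / Wpa v / Real.sqrt R := by
    rw [div_div, le_div_iff₀ (mul_pos hWpos (Real.sqrt_pos.2 hR0))]
    have h1' : Wpa v * (∫ x, θ x * ‖curl v x‖ ^ 2) ≤ C / Real.sqrt R := by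
      have := mul_nonneg hZ0 hF0; linarith
    have h2' := (le_div_iff₀ (Real.sqrt_pos.2 hR0)).1 h1'
    linarith [h2']
  -- `θ = 1` on `S`
  have hθ1 : ∀ x ∈ S, θ x = 1 := by
    intro x hx
    have h2R : 2 * R ≤ ‖x‖ := hSsub hx
    have hxn : ‖x‖ ≤ R' := by
      have := hρ₁ hx; rw [mem_closedBall, dist_zero_right] at this; exact this.trans (le_max_right _ _)
    exact radialCutoff_eq_one hR0 hR'0 h2R hxn
  have cFv : Continuous (fun x => frobeniusNormSq (fderiv ℝ v x)) :=
    continuous_frobeniusNormSq_fderiv (hv.of_le (by norm_cast)) one_ne_zero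
  have hS' := setIntegral_le_integral_mul_of_eq_one cFv (fun x => frobeniusNormSq_nonneg _) hθ.continuous hθc hθ0 hS hSb hθ1
  -- `1/R ≤ 1/√R`
  have hsqrtR : 0 < Real.sqrt R := Real.sqrt_pos.2 hR0
  have hsqrtR1 : 1 ≤ Real.sqrt R := by rw [← Real.sqrt_one]; exact Real.sqrt_le_sqrt hR1
  have hRle : 19 * K * E₀ / R ≤ 19 * K * E₀ / Real.sqrt R := by
    refine div_le_div_of_nonneg_left (by positivity) hsqrtR ?_
    calc Real.sqrt R ≤ Real.sqrt R * Real.sqrt R := le_mul_of_one_le_right hsqrtR.le hsqrtR1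
      _ = R := Real.mul_self_sqrt hR0.le
  calc (∫ x in S, frobeniusNormSq (fderiv ℝ v x)) ≤ ∫ x, θ x * frobeniusNormSq (fderiv ℝ v x) := hS'
    _ ≤ C / Wpa v / Real.sqrt R + 19 * K * E₀ / Real.sqrt R := by linarith [hloc, hZθ, hT3, hRle]
    _ = (C / Wpa v + 19 * K * E₀) / Real.sqrt R := by ring

/-- **The Dirichlet-energy tail on the whole exterior region** `{2R ≤ ‖x‖}` (monotone convergence). [folklore] -/
theorem tailDirichlet_jet_exterior
    (hv : ContDiff ℝ ∞ v) (hdiv : VectorCalculus.IsDivFree v) {M B : ℝ} (hMpos : 0 < M)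
    (hM : ∀ x, ‖v x‖ = M) (hcM : ‖c‖ = M) (hB : ∀ x, ‖fderiv ℝ v x‖ ≤ B)
    (h1 : ∫⁻ x, ‖iteratedFDeriv ℝ 1 v x‖ₑ ^ 2 < ⊤) (h2 : ∫⁻ x, ‖iteratedFDeriv ℝ 2 v x‖ₑ ^ 2 < ⊤)
    (hpos : 0 < M * Real.sqrt (Zen v) * Real.sqrt (Wpa v))
    (hatt : |Jst v| = kStar * M * Real.sqrt (Zen v) * Real.sqrt (Wpa v))
    (hc0 : c 0 = 0) (hc1 : c 1 = 0) (hc2 : c 2 ≠ 0)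
    (hfar : Tendsto (fun x => v x - c) (cocompact E3) (𝓝 0))
    (hslab : ∀ T : ℝ, 0 < T → Integrable (fun x => {x : E3 | |x 2| ≤ T}.indicator (fun x => ‖v x - c‖ ^ 2) x) volume)
    {E₀ : ℝ} (hE0 : 0 ≤ E₀) (hE : ∀ s : ℝ, (∫ x, deriv Real.smoothTransition (x 2 - s) * ‖v x - c‖ ^ 2) = E₀) :
    ∃ C : ℝ, 0 ≤ C ∧ ∃ R₀ : ℝ, 1 ≤ R₀ ∧ ∀ R : ℝ, R₀ ≤ R →
      (∫ x in {x : E3 | 2 * R ≤ ‖x‖}, frobeniusNormSq (fderiv ℝ v x)) ≤ C / Real.sqrt R := by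
  obtain ⟨C, hC, R₀, hR₀, h⟩ := tailDirichlet_jet hv hdiv hMpos hM hcM hB h1 h2 hpos hatt hc0 hc1 hc2 hfar hslab hE0 hE
  refine ⟨C, hC, R₀, hR₀, fun R hR => ?_⟩
  set T : Set E3 := {x : E3 | 2 * R ≤ ‖x‖} with hTdef
  have hT : MeasurableSet T := measurableSet_le measurable_const measurable_norm
  set s : ℕ → Set E3 := fun n => T ∩ ball (0 : E3) (n + 1) with hsdef
  have hsm : ∀ n, MeasurableSet (s n) := fun n => hT.inter measurableSet_ball
  have hmono : Monotone s := fun m n hmn => inter_subset_inter_right _ (ball_subset_ball (by exact_mod_cast Nat.succ_le_succ hmn))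
  have hU : (⋃ n, s n) = T := by
    refine Subset.antisymm (iUnion_subset fun n => inter_subset_left) fun x hx => ?_
    obtain ⟨n, hn⟩ := exists_nat_gt ‖x‖
    exact mem_iUnion.2 ⟨n, hx, by rw [mem_ball, dist_zero_right]; linarith⟩
  have iD2 : Integrable (fun x => ‖fderiv ℝ v x‖ ^ 2) volume := by
    have h1' : ∫⁻ x, ‖fderiv ℝ v x‖ₑ ^ 2 < ⊤ := by
      refine lt_of_le_of_lt (le_of_eq (lintegral_congr fun x => ?_)) h1
      rw [← ofReal_norm, ← ofReal_norm, norm_iteratedFDeriv_one]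
    exact integrable_sq_norm_of_lintegral_lt_top (hv.continuous_fderiv (by simp)) h1'
  have hfrob : ∀ x, frobeniusNormSq (fderiv ℝ v x) ≤ 3 * ‖fderiv ℝ v x‖ ^ 2 := fun x => by
    have h := ofReal_frobeniusNormSq_le_three_mul_enorm_sq (fderiv ℝ v x)
    have e3 : (3 : ℝ≥0∞) * ENNReal.ofReal (‖fderiv ℝ v x‖ ^ 2) = ENNReal.ofReal (3 * ‖fderiv ℝ v x‖ ^ 2) := by
      rw [ENNReal.ofReal_mul (by norm_num : (0 : ℝ) ≤ 3), ENNReal.ofReal_ofNat]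
    rw [← ofReal_norm, ← ENNReal.ofReal_pow (norm_nonneg _), e3] at h
    exact (ENNReal.ofReal_le_ofReal_iff (by positivity)).1 h
  have cFv : Continuous (fun x => frobeniusNormSq (fderiv ℝ v x)) :=
    continuous_frobeniusNormSq_fderiv (hv.of_le (by norm_cast)) one_ne_zero
  have iD : Integrable (fun x => frobeniusNormSq (fderiv ℝ v x)) volume :=
    (iD2.const_mul 3).mono' cFv.aestronglyMeasurable (Eventually.of_forall fun x => by
      rw [Real.norm_eq_abs, abs_of_nonneg (frobeniusNormSq_nonneg _)]; exact hfrob x)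
  have tD := tendsto_setIntegral_of_monotone (μ := volume) hsm hmono iD.integrableOn
  rw [hU] at tD
  exact le_of_tendsto' tD fun n => h R hR (s n) (hsm n) (isBounded_ball.subset inter_subset_right) inter_subset_left

/-- **AXIAL DOSSIER v4 (g7, final).**  K1b VERBATIM ⟸ no axial residue object with the v3 list — residue data, multiplier,
(S₀), (V₀), (A), (NC), (NR), (NW) — PLUS the quantitative laws of g7: (SL) the slab law `O(1/R)` and (TL) the radial tail laws
`O(R^{-1/2})` (weighted enstrophy–palinstrophy and Dirichlet energy), and the flat-or-jet alternative.  (K1b itself is NOT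
proved here.) [folklore] -/
theorem stub_noAnalyticExtremal_of_noAxialResidueObject₄
    (hres : ∀ (w : E3 → E3) (c : E3) (M : ℝ) (μ : Measure E3),
      AnalyticOnNhd ℝ w Set.univ → ContDiff ℝ (⊤ : ℕ∞) w → VectorCalculus.IsDivFree w →
      (∃ B : ℝ, ∀ x, ‖fderiv ℝ w x‖ ≤ B) → (∫⁻ x, ‖iteratedFDeriv ℝ 1 w x‖ₑ ^ 2 < ⊤) → (∫⁻ x, ‖iteratedFDeriv ℝ 2 w x‖ₑ ^ 2 < ⊤) →
      (∀ x, ‖w x‖ = M) → 0 < M → c 0 = 0 → c 1 = 0 → c 2 ≠ 0 → ‖c‖ = M →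
      Tendsto (fun x => w x - c) (cocompact E3) (𝓝 0) → MemLp (fun x => w x - c) 6 volume →
      0 < M * Real.sqrt (Zen w) * Real.sqrt (Wpa w) → kStar * M * Real.sqrt (Zen w) * Real.sqrt (Wpa w) = |Jst w| →
      -- the multiplier: finite, exact mass, the multiplier equation, zero barycentre
      IsFiniteMeasure μ → M ^ 2 * μ.real univ = Jst w ^ 2 →
      (∀ φ : E3 → E3, ContDiff ℝ ∞ φ → HasCompactSupport φ → VectorCalculus.IsDivFree φ →
        Jst w * J1 w φ - kStar ^ 2 * M ^ 2 * (Wpa w * A1 w φ + Zen w * C1 w φ) = ∫ x, ⟪w x, φ x⟫_ℝ ∂μ) →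
      (∫ x, w x ∂μ) = 0 →
      -- (S₀) the Stokeslet law without point force
      (∀ (c' : E3) (Ψ : E3 → E3), ContDiff ℝ ∞ Ψ → HasCompactSupport Ψ → VectorCalculus.IsDivFree Ψ →
        Tendsto (fun R : ℝ => kStar ^ 2 * M ^ 2 * Wpa w * (R⁻¹ * R⁻¹ * ∫ x, ⟪w x - c', (Δ Ψ) (R⁻¹ • x)⟫_ℝ)) atTop (𝓝 0)) →
      -- (V₀) the blow-down vorticity vanishes in `𝒟′`
      (∀ B : E3 → E3, ContDiff ℝ ∞ B → HasCompactSupport B →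
        Tendsto (fun R : ℝ => R⁻¹ * ∫ x, ⟪curl w x, B (R⁻¹ • x)⟫_ℝ) atTop (𝓝 0)) →
      -- (A) the multiplier has no atoms
      (∀ x₀ : E3, μ {x₀} = 0) →
      -- (NC) not an asymptotically conical jet
      (∀ (Cg : ℝ), 0 ≤ Cg → (∀ ρ : ℝ, 1 ≤ ρ → ∫⁻ x in ball (0 : E3) ρ, ‖w x - c‖ₑ ^ 2 ≤ ENNReal.ofReal (Cg * ρ)) →
        ∀ (e₀ L₀ : ℝ), 0 < e₀ → 0 < L₀ →
        (∀ R : ℝ, 1 ≤ R → ENNReal.ofReal (e₀ * R) ≤ ∫⁻ x in ball (0 : E3) (R * L₀), ‖w x - c‖ₑ ^ 2) →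
        ∀ U : E3 → E3, AEStronglyMeasurable U volume → (∀ R : ℝ, 0 < R → ∀ x, R • U (R • x) = U x) →
        ¬ (∀ L : ℝ, 0 < L →
          Tendsto (fun R : ℝ => ENNReal.ofReal R⁻¹ * ∫⁻ x in ball (0 : E3) (R * L), ‖w x - c - U x‖ₑ ^ 2) atTop (𝓝 0))) →
      -- (NR) in the jet case, no annular `H¹` rate along energetic windows
      ((∀ T : ℝ, 0 < T → Integrable (fun x => {x : E3 | |x 2| ≤ T}.indicator (fun x => ‖w x - c‖ ^ 2) x) volume) →
        ∀ (E₀ : ℝ), 0 < E₀ → (∀ s : ℝ, (∫ x, deriv Real.smoothTransition (x 2 - s) * ‖w x - c‖ ^ 2) = E₀) →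
        ∀ (Rn : ℕ → ℝ), (∀ n, 1 ≤ Rn n) → Tendsto Rn atTop atTop →
        ∀ (x₁ : E3) (L₁ : ℝ), ball x₁ (L₁ + 1) ⊆ ball (0 : E3) 4 \ closedBall (0 : E3) 2⁻¹ →
        ∀ (A : ℝ≥0∞), A ≠ ⊤ → ∀ (e₀ : ℝ), 0 < e₀ →
        (∀ n, ENNReal.ofReal (e₀ * Rn n) ≤ ∫⁻ y in ball (Rn n • x₁) (Rn n * L₁), ‖w y - c‖ₑ ^ 2) →
        ¬ (∀ n, ENNReal.ofReal (Rn n) * ∫⁻ y in ball (0 : E3) (4 * Rn n) \ closedBall (0 : E3) (2⁻¹ * Rn n),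
          ‖fderiv ℝ w y‖ₑ ^ 2 ≤ A)) →
      -- (NW) NEW: in the jet case, NO energetic axial window
      ((∀ T : ℝ, 0 < T → Integrable (fun x => {x : E3 | |x 2| ≤ T}.indicator (fun x => ‖w x - c‖ ^ 2) x) volume) →
        ∀ (E₀ : ℝ), 0 < E₀ → (∀ s : ℝ, (∫ x, deriv Real.smoothTransition (x 2 - s) * ‖w x - c‖ ^ 2) = E₀) →
        ∀ (Rn : ℕ → ℝ), (∀ n, 1 ≤ Rn n) → Tendsto Rn atTop atTop →
        ∀ (x₁ : E3) (L₁ : ℝ), ball x₁ (L₁ + 1) ⊆ {y : E3 | 2⁻¹ ≤ y 2 ∧ y 2 ≤ 6} →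
        ∀ (e₀ : ℝ), 0 < e₀ →
        ¬ (∀ n, ENNReal.ofReal (e₀ * Rn n) ≤ ∫⁻ y in ball (Rn n • x₁) (Rn n * L₁), ‖w y - c‖ₑ ^ 2)) →
      -- (SL) NEW: in the jet case, THE SLAB LAW `O(1/R)` on `{R/2 ≤ x₂ ≤ 6R}` (g7, `jet_slabRate`)
      ((∀ T : ℝ, 0 < T → Integrable (fun x => {x : E3 | |x 2| ≤ T}.indicator (fun x => ‖w x - c‖ ^ 2) x) volume) →
        ∀ (E₀ : ℝ), 0 < E₀ → (∀ s : ℝ, (∫ x, deriv Real.smoothTransition (x 2 - s) * ‖w x - c‖ ^ 2) = E₀) →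
        ∃ C : ℝ, 0 ≤ C ∧ ∃ R₀ : ℝ, 1 ≤ R₀ ∧ ∀ R : ℝ, R₀ ≤ R → ∀ S : Set E3, MeasurableSet S → Bornology.IsBounded S →
          S ⊆ {x : E3 | R / 2 ≤ x 2 ∧ x 2 ≤ 6 * R} →
          Wpa w * (∫ x in S, ‖curl w x‖ ^ 2) + Zen w * (∫ x in S, frobeniusNormSq (fderiv ℝ (curl w) x)) ≤ C / R ∧
          (∫ x in S, frobeniusNormSq (fderiv ℝ w x)) ≤ C / R) →
      -- (TL) NEW: in the jet case, THE RADIAL TAIL LAWS `O(R^{-1/2})` on `{2R ≤ ‖x‖}` (g7, `tailLaw_jet_exterior`,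
      -- `tailDirichlet_jet_exterior`)
      ((∀ T : ℝ, 0 < T → Integrable (fun x => {x : E3 | |x 2| ≤ T}.indicator (fun x => ‖w x - c‖ ^ 2) x) volume) →
        ∀ (E₀ : ℝ), 0 < E₀ → (∀ s : ℝ, (∫ x, deriv Real.smoothTransition (x 2 - s) * ‖w x - c‖ ^ 2) = E₀) →
        ∃ C : ℝ, 0 ≤ C ∧ ∃ R₀ : ℝ, 1 ≤ R₀ ∧ ∀ R : ℝ, R₀ ≤ R →
          Wpa w * (∫ x in {x : E3 | 2 * R ≤ ‖x‖}, ‖curl w x‖ ^ 2) +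
              Zen w * (∫ x in {x : E3 | 2 * R ≤ ‖x‖}, frobeniusNormSq (fderiv ℝ (curl w) x)) ≤ C / Real.sqrt R ∧
          (∫ x in {x : E3 | 2 * R ≤ ‖x‖}, frobeniusNormSq (fderiv ℝ w x)) ≤ C / Real.sqrt R) →
      -- (F/J) the axial flat-or-jet alternative is excluded
      ¬ ((∃ T : ℝ, 0 < T ∧ ¬ Integrable (fun x => {x : E3 | |x 2| ≤ T}.indicator (fun x => ‖w x - c‖ ^ 2) x) volume) ∨
         ((∀ T : ℝ, 0 < T → Integrable (fun x => {x : E3 | |x 2| ≤ T}.indicator (fun x => ‖w x - c‖ ^ 2) x) volume) ∧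
           ∃ E₀ : ℝ, 0 < E₀ ∧ ∀ s : ℝ, (∫ x, deriv Real.smoothTransition (x 2 - s) * ‖w x - c‖ ^ 2) = E₀))) :
    ¬ ∃ (w : EuclideanSpace ℝ (Fin 3) → EuclideanSpace ℝ (Fin 3)), AnalyticOnNhd ℝ w Set.univ ∧ (ContDiff ℝ (⊤ : ℕ∞) w ∧ Literature.Analysis.FluidPDE.VectorCalculus.IsDivFree w ∧ (∃ B : ℝ, ∀ x, ‖fderiv ℝ w x‖ ≤ B) ∧ (∫⁻ x, ‖iteratedFDeriv ℝ 1 w x‖ₑ ^ 2 < ⊤) ∧ (∫⁻ x, ‖iteratedFDeriv ℝ 2 w x‖ₑ ^ 2 < ⊤) ∧ ∃ M : ℝ, (∀ x, ‖w x‖ ≤ M) ∧ 0 < M * Real.sqrt (∫ x, ‖Literature.Analysis.FluidPDE.curl w x‖ ^ 2) * Real.sqrt (∫ x, Literature.Analysis.FluidPDE.frobeniusNormSq (fderiv ℝ (Literature.Analysis.FluidPDE.curl w) x)) ∧ (sInf {κ : ℝ | (∀ (v : EuclideanSpace ℝ (Fin 3) → EuclideanSpace ℝ (Fin 3)) (M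 B : ℝ), ContDiff ℝ (⊤ : ℕ∞) v → Literature.Analysis.FluidPDE.VectorCalculus.IsDivFree v → (∀ x, ‖v x‖ ≤ M) → (∀ x, ‖fderiv ℝ v x‖ ≤ B) → (∫⁻ x, ‖iteratedFDeriv ℝ 0 v x‖ₑ ^ 2 < ⊤) → (∫⁻ x, ‖iteratedFDeriv ℝ 1 v x‖ₑ ^ 2 < ⊤) → (∫⁻ x, ‖iteratedFDeriv ℝ 2 v x‖ₑ ^ 2 < ⊤) → |∫ x, ⟪Literature.Analysis.FluidPDE.curl v x, fderiv ℝ v x (Literature.Analysis.FluidPDE.curl v x)⟫_ℝ| ≤ κ * M * Real.sqrt (∫ x, ‖Literature.Analysis.FluidPDE.curl v x‖ ^ 2) * Real.sqrt (∫ x, Literature.Analysis.FluidPDE.frobeniusNormSq (fderiv ℝ (Literature.Analysis.FluidPDE.curl v) x)))}) * M * Real.sqrt (∫ x, ‖Literature.Analysis.FluidPDE.curl w x‖ ^ 2) * Real.sqrt (∫ x, Literature.Analysis.FluidPDE.frobeniusNormSq (fderiv ℝ (Literature.Analysis.FluidPDE.curl w) x)) ≤ |∫ x, ⟪Literature.Analysis.FluidPDE.curl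 w x, fderiv ℝ w x (Literature.Analysis.FluidPDE.curl w x)⟫_ℝ|) := by
  refine stub_noAnalyticExtremal_of_noAxialResidueObject₃
    fun w c M μ han hcd hdiv hB h1 h2 hM hMpos hc0 hc1 hc2 hcM hfar hL6 hpos heq hfin hmass hμ hb hS0 hV0 hA hNC hNR hNW => ?_
  obtain ⟨B, hBw⟩ := hB
  -- (SL)
  have hSL : (∀ T : ℝ, 0 < T → Integrable (fun x => {x : E3 | |x 2| ≤ T}.indicator (fun x => ‖w x - c‖ ^ 2) x) volume) →
      ∀ (E₀ : ℝ), 0 < E₀ → (∀ s : ℝ, (∫ x, deriv Real.smoothTransition (x 2 - s) * ‖w x - c‖ ^ 2) = E₀) →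
      ∃ C : ℝ, 0 ≤ C ∧ ∃ R₀ : ℝ, 1 ≤ R₀ ∧ ∀ R : ℝ, R₀ ≤ R → ∀ S : Set E3, MeasurableSet S → Bornology.IsBounded S →
        S ⊆ {x : E3 | R / 2 ≤ x 2 ∧ x 2 ≤ 6 * R} →
        Wpa w * (∫ x in S, ‖curl w x‖ ^ 2) + Zen w * (∫ x in S, frobeniusNormSq (fderiv ℝ (curl w) x)) ≤ C / R ∧
        (∫ x in S, frobeniusNormSq (fderiv ℝ w x)) ≤ C / R :=
    fun hslab E₀ hE0 hE => jet_slabRate hcd hdiv hMpos hM hcM hBw h1 h2 hpos heq.symm hc0 hc1 hc2 hfar hslab hE0.le hE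
  -- (TL)
  have hTL : (∀ T : ℝ, 0 < T → Integrable (fun x => {x : E3 | |x 2| ≤ T}.indicator (fun x => ‖w x - c‖ ^ 2) x) volume) →
      ∀ (E₀ : ℝ), 0 < E₀ → (∀ s : ℝ, (∫ x, deriv Real.smoothTransition (x 2 - s) * ‖w x - c‖ ^ 2) = E₀) →
      ∃ C : ℝ, 0 ≤ C ∧ ∃ R₀ : ℝ, 1 ≤ R₀ ∧ ∀ R : ℝ, R₀ ≤ R →
        Wpa w * (∫ x in {x : E3 | 2 * R ≤ ‖x‖}, ‖curl w x‖ ^ 2) +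
            Zen w * (∫ x in {x : E3 | 2 * R ≤ ‖x‖}, frobeniusNormSq (fderiv ℝ (curl w) x)) ≤ C / Real.sqrt R ∧
        (∫ x in {x : E3 | 2 * R ≤ ‖x‖}, frobeniusNormSq (fderiv ℝ w x)) ≤ C / Real.sqrt R := by
    intro hslab E₀ hE0 hE
    obtain ⟨C₁, hC₁, R₁, hR₁, hT₁⟩ :=
      tailLaw_jet_exterior hcd hdiv hMpos hM hcM hBw h1 h2 hpos heq.symm hc0 hc1 hc2 hfar hslab hE0.le hE
    obtain ⟨C₂, hC₂, R₂, hR₂, hT₂⟩ :=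
      tailDirichlet_jet_exterior hcd hdiv hMpos hM hcM hBw h1 h2 hpos heq.symm hc0 hc1 hc2 hfar hslab hE0.le hE
    refine ⟨max C₁ C₂, hC₁.trans (le_max_left _ _), max R₁ R₂, hR₁.trans (le_max_left _ _), fun R hR => ⟨?_, ?_⟩⟩
    · have hRpos : 0 < Real.sqrt R := Real.sqrt_pos.2 (by linarith [le_max_left R₁ R₂])
      exact (hT₁ R ((le_max_left _ _).trans hR)).trans (div_le_div_of_nonneg_right (le_max_left _ _) hRpos.le)
    · have hRpos : 0 < Real.sqrt R := Real.sqrt_pos.2 (by linarith [le_max_right R₁ R₂])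
      exact (hT₂ R ((le_max_right _ _).trans hR)).trans (div_le_div_of_nonneg_right (le_max_right _ _) hRpos.le)
  exact hres w c M μ han hcd hdiv ⟨B, hBw⟩ h1 h2 hM hMpos hc0 hc1 hc2 hcM hfar hL6 hpos heq hfin hmass hμ hb hS0 hV0 hA hNC hNR
    hNW hSL hTL

end ExtremiserLiouville

end Summit.NavierStokesRegularity.NavierStokesRegularity.Theorems

end
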